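import Summits.KontsevichZagierPeriods.KontsevichZagierPeriods.Theorems.PlanarK0Injective.Negative.Kit

/-!
# `PlanarSAZylev` (stmt-KontsevichZagierPeriods-9848) — negative side, kit: conclusion shape, strength, models

Kit for the negative/structural knowledge on the crux `SymplecticScissors.PlanarSAZylev`
("planar semialgebraic Zylev": membership of `[r] − [r']` in the planar set-chain group forces
equidecomposability of `r`, `r'` modulo null sets by ONE change-of-variables instance).  Refuter,
cdisprove cycle 1; the full analysis and a paper proof of the crux are in the crux work file
`Cruxes/PlanarSAZylev/Disproof.lean`.  Builds on the sibling kit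
`Theorems/PlanarK0Injective/Negative/Kit.lean` (`planarGens`, `planarGroup`, soundness, free-group
pinning).  Everything is `sorry`-free.

* `SymplecticScissors.PlanarTransport` (before §0) — the Monge form, the RETIRED support item
  stmt-KontsevichZagierPeriods-9849 (dropped from `Theses.SymplecticScissors` by the items-cap autofix of
  2026-08-16T14:16:23Z, `moot`), re-homed here with its registered signature verbatim in the Theorems-side
  parent namespace `Summit.KontsevichZagierPeriods.SymplecticScissors`, so that every `PlanarTransport`
  below and in the importers working in `…SymplecticScissors.*` namespaces (`Negative/NonVacuity.lean`,
  `Negative/NullSets.lean`, `Theorems/SymplecticScissorsPlanarTransport.lean`) keeps denoting it with all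
  statements textually unchanged (dependency-drift repair 2026-08-17).
* §0 `Equidecomposable` — the conclusion shape of the crux (= the conclusion of the Monge form
  `PlanarTransport`); `planarSAZylev_iff`, `planarTransport_iff` are `Iff.rfl`.
* §1 STRENGTH: the group hypothesis forces equal values (`value_eq_of_sub_mem_planarGroup`), hence
  **`PlanarTransport → PlanarSAZylev`** and, over `PlanarK0Injective`,
  `PlanarTransport ↔ PlanarSAZylev`: any counterexample to the crux is a counterexample to the
  open Monge problem (two equal-area planar `ℚ`-regions not Nash-symplectically equidecomposable).
* §2 witness models: the open unit square `sq`, the far point `qpt = (5,5)`, `oneRep σ`,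
  `sqRep`, `ptRep`, `sqPtRep = [(0,1)² ∪ {q}, 1]`, `planeRep = [ℝ², 1/(2∏(1+xᵢ²))]` (finite value,
  infinite area).
* §3 soundness/sanity of the conclusion shape: `0 ∈ changeOfVariablesRel`, reflexivity on
  integrand-1 representations (`Φ = id`), null pairs, and **`value_eq_of_equidecomposable`**
  (equidecomposable ⟹ equal area: no junk instance of the conclusion across areas).
[Kontsevich–Zagier 2001 §1.2; Sah 1979 Ch. 1 Thm 3.1 (Zylev); Boltianskii 1978 Thm 22]
-/

noncomputable section

open Set MeasureTheory MvPolynomial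
open Literature.NumberTheory.Transcendental Literature.ModelTheory.ExponentialFields
open Summit.KontsevichZagierPeriods.KontsevichZagierPeriods.Theses.SymplecticScissors

/-! ## The Monge form (retired route decl, re-homed) -/

namespace Summit.KontsevichZagierPeriods.SymplecticScissors

/-- **The Monge form `PlanarTransport`** — RETIRED support item stmt-KontsevichZagierPeriods-9849 of route
`SymplecticScissors` (the route's headline "curved Bolyai–Gerwien over `ℚ̄`": two planar `ℚ`-regions,
i.e. integrand-`1` integral representations in dimension `2`, of EQUAL finite area have full-measure
`ℚ`-semialgebraic integrand-`1` restrictions `s ⊆ r`, `s' ⊆ r'` related by ONE change-of-variables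
instance, `KZ.of s - KZ.of s' ∈ KZ.changeOfVariablesRel`; equivalent to `PlanarK0Injective ∧ PlanarSAZylev`,
`PlanarSAZylevNegative.planarTransport_iff_planarSAZylev` below). The generated route file
`Theses.SymplecticScissors` dropped the decl on 2026-08-16T14:16:23Z (items-cap autofix, item closed `moot`;
its text survives there as a comment), which broke this kit and its importers. Re-homed here with the item's
registered signature VERBATIM, deliberately in the Theorems-side parent namespace (full name
`Summit.KontsevichZagierPeriods.SymplecticScissors.PlanarTransport`, NOT the route namespace): namespace
resolution makes every short `PlanarTransport` in the `Summit.KontsevichZagierPeriods.SymplecticScissors.*`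
namespaces of this kit and of its importers denote it (it takes precedence over `open`ed namespaces), so all
theorem statements stay textually unchanged and no global name of the route namespace is re-declared. An
OPEN problem (Monge / symplectic scissors congruence modulo null sets for planar `ℚ`-regions), posed as a
`Prop`, never asserted. [folklore] [status: open] -/
@[conjecture] def PlanarTransport : Prop :=
  ∀ (r r' : Literature.NumberTheory.Transcendental.KZ.IntegralRep 2), (∀ p ∈ r.domain, r.integrand p = 1) → (∀ p ∈ r'.domain, r'.integrand p = 1) → r.value = r'.value → ∃ (s s' : Literature.NumberTheory.Transcendental.KZ.IntegralRep 2), s.domain ⊆ r.domain ∧ MeasureTheory.volume (r.domain \ s.domain) = 0 ∧ s'.domain ⊆ r'.domain ∧ MeasureTheory.volume (r'.domain \ s'.domain) = 0 ∧ (∀ p ∈ s.domain, s.integrand p = 1) ∧ (∀ p ∈ s'.domain, s'.integrand p = 1) ∧ Literature.NumberTheory.Transcendental.KZ.of s - Literature.NumberTheory.Transcendental.KZ.of s' ∈ Literature.NumberTheory.Transcendental.KZ.changeOfVariablesRel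

end Summit.KontsevichZagierPeriods.SymplecticScissors

namespace Summit.KontsevichZagierPeriods.SymplecticScissors.PlanarSAZylevNegative

open PlanarK0InjectiveNegative (planarGens planarGroup planarGroup_le_relations
  eval_eq_zero_of_mem_planarGroup eq_of_of_sub_of_eq isSemialgebraicFunOn_one)

/-! ## §0 The conclusion shape -/

/-- The conclusion shape of the crux (and of the Monge form `PlanarTransport`): `r` and `r'` are
*equidecomposable modulo null sets by ONE change-of-variables instance* between full-measure
`ℚ`-semialgebraic integrand-1 restrictions `s ⊆ r`, `s' ⊆ r'`. [folklore] -/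
def Equidecomposable (r r' : KZ.IntegralRep 2) : Prop :=
  ∃ (s s' : KZ.IntegralRep 2), s.domain ⊆ r.domain ∧ volume (r.domain \ s.domain) = 0 ∧
    s'.domain ⊆ r'.domain ∧ volume (r'.domain \ s'.domain) = 0 ∧
    (∀ p ∈ s.domain, s.integrand p = 1) ∧ (∀ p ∈ s'.domain, s'.integrand p = 1) ∧
    KZ.of s - KZ.of s' ∈ KZ.changeOfVariablesRel

/-- The crux, verbatim, through `planarGroup` and `Equidecomposable` (`Iff.rfl`). [folklore] -/
theorem planarSAZylev_iff :
    PlanarSAZylev ↔ ∀ r r' : KZ.IntegralRep 2, (∀ p ∈ r.domain, r.integrand p = 1) →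
      (∀ p ∈ r'.domain, r'.integrand p = 1) →
      KZ.of r - KZ.of r' ∈ planarGroup → Equidecomposable r r' :=
  Iff.rfl

/-- The Monge form, verbatim, through `Equidecomposable` (`Iff.rfl`). [folklore] -/
theorem planarTransport_iff :
    PlanarTransport ↔ ∀ r r' : KZ.IntegralRep 2, (∀ p ∈ r.domain, r.integrand p = 1) →
      (∀ p ∈ r'.domain, r'.integrand p = 1) → r.value = r'.value → Equidecomposable r r' :=
  Iff.rfl

/-! ## §1 Strength: the crux sits below the Monge form -/

/-- **The group hypothesis of the crux forces equal values** (soundness of moves (1a), (2)). [folklore] -/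
theorem value_eq_of_sub_mem_planarGroup {r r' : KZ.IntegralRep 2}
    (h : KZ.of r - KZ.of r' ∈ planarGroup) : r.value = r'.value := by
  have := eval_eq_zero_of_mem_planarGroup h
  rwa [map_sub, KZ.eval_of, KZ.eval_of, sub_eq_zero] at this

/-- **The crux is implied by the Monge form.** Consequently ANY counterexample to `PlanarSAZylev` is
a counterexample to `PlanarTransport`: two planar `ℚ`-regions of equal area that are not
Nash-symplectically equidecomposable modulo null sets — an open problem. [folklore] -/
theorem planarSAZylev_of_planarTransport : PlanarTransport → PlanarSAZylev :=
  fun hT r r' h1 h2 hG => hT r r' h1 h2 (value_eq_of_sub_mem_planarGroup hG)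

/-- The route's headline assembly: `PlanarK0Injective ∧ PlanarSAZylev → PlanarTransport`. [folklore] -/
theorem planarTransport_of (hK : PlanarK0Injective) (hZ : PlanarSAZylev) : PlanarTransport :=
  fun r r' h1 h2 hv => hZ r r' h1 h2 (hK r r' h1 h2 hv)

/-- Over `PlanarK0Injective` the crux and the Monge form are the same statement. [folklore] -/
theorem planarTransport_iff_planarSAZylev (hK : PlanarK0Injective) :
    PlanarTransport ↔ PlanarSAZylev :=
  ⟨planarSAZylev_of_planarTransport, planarTransport_of hK⟩

/-! ## §2 Small `ℚ`-semialgebraic witness models -/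

section Models

variable {n : ℕ}

/-- `{x | a < xᵢ}` is `ℚ`-semialgebraic (`0 < Xᵢ − a`). [folklore] -/
theorem isSemialgebraic_coord_gt (i : Fin n) (a : ℚ) :
    IsSemialgebraic ℚ {x : Fin n → ℝ | (a : ℝ) < x i} := by
  convert isSemialgebraic_setOf_eval_pos (R := ℝ) (X i - C a : MvPolynomial (Fin n) ℚ) using 1
  ext x
  simp [sub_pos]

/-- `{x | xᵢ < b}` is `ℚ`-semialgebraic (`0 < b − Xᵢ`). [folklore] -/
theorem isSemialgebraic_coord_lt (i : Fin n) (b : ℚ) :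
    IsSemialgebraic ℚ {x : Fin n → ℝ | x i < (b : ℝ)} := by
  convert isSemialgebraic_setOf_eval_pos (R := ℝ) (C b - X i : MvPolynomial (Fin n) ℚ) using 1
  ext x
  simp [sub_pos]

/-- `{x | xᵢ = a}` is `ℚ`-semialgebraic (`Xᵢ − a = 0`). [folklore] -/
theorem isSemialgebraic_coord_eq (i : Fin n) (a : ℚ) :
    IsSemialgebraic ℚ {x : Fin n → ℝ | x i = (a : ℝ)} := by
  convert isSemialgebraic_setOf_eval_eq_zero (R := ℝ) (X i - C a : MvPolynomial (Fin n) ℚ) using 1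
  ext x
  simp [sub_eq_zero]

/-- The open unit square `(0,1)²`. [folklore] -/
def sq : Set (Fin 2 → ℝ) := Set.pi univ fun _ => Ioo 0 1

/-- `sq` as an intersection of coordinate half-spaces with rational thresholds. [folklore] -/
theorem sq_eq : sq = ({x | ((0 : ℚ) : ℝ) < x 0} ∩ {x | x 0 < ((1 : ℚ) : ℝ)}) ∩
    ({x | ((0 : ℚ) : ℝ) < x 1} ∩ {x | x 1 < ((1 : ℚ) : ℝ)}) := by
  ext x
  simp [sq, Set.mem_pi, Fin.forall_fin_two]

/-- The open unit square is `ℚ`-semialgebraic. [folklore] -/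
theorem isSemialgebraic_sq : IsSemialgebraic ℚ sq := by
  rw [sq_eq]
  exact ((isSemialgebraic_coord_gt 0 0).inter (isSemialgebraic_coord_lt 0 1)).inter
    ((isSemialgebraic_coord_gt 1 0).inter (isSemialgebraic_coord_lt 1 1))

/-- The open unit square has area `1`. [folklore] -/
theorem volume_sq : volume sq = 1 := by
  have := Real.volume_pi_Ioo (a := fun _ : Fin 2 => (0 : ℝ)) (b := fun _ => 1)
  simpa [sq] using this

/-- The open unit square is convex. [folklore] -/
theorem convex_sq : Convex ℝ sq := convex_pi fun _ _ => convex_Ioo 0 1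

/-- Membership in the open unit square, coordinatewise. [folklore] -/
theorem mem_sq {x : Fin 2 → ℝ} : x ∈ sq ↔ ∀ i, 0 < x i ∧ x i < 1 := by
  simp [sq, Set.mem_pi]

/-- The far point `q = (5, 5)`. [folklore] -/
def qpt : Fin 2 → ℝ := fun _ => 5

/-- `{q}` as an intersection of two coordinate hyperplanes with rational levels. [folklore] -/
theorem singleton_qpt_eq : ({qpt} : Set (Fin 2 → ℝ)) =
    {x | x 0 = ((5 : ℚ) : ℝ)} ∩ {x | x 1 = ((5 : ℚ) : ℝ)} := by
  ext x
  simp only [mem_singleton_iff, mem_inter_iff, mem_setOf_eq, Rat.cast_ofNat]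
  constructor
  · rintro rfl; exact ⟨rfl, rfl⟩
  · rintro ⟨h0, h1⟩
    funext i
    fin_cases i <;> assumption

/-- `{q}` is `ℚ`-semialgebraic. [folklore] -/
theorem isSemialgebraic_singleton_qpt : IsSemialgebraic ℚ ({qpt} : Set (Fin 2 → ℝ)) := by
  rw [singleton_qpt_eq]
  exact (isSemialgebraic_coord_eq 0 5).inter (isSemialgebraic_coord_eq 1 5)

/-- `q ∉ (0,1)²`. [folklore] -/
theorem qpt_not_mem_sq : qpt ∉ sq := by
  intro h
  have := (mem_sq.mp h 0).2
  norm_num [qpt] at this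

/-- `{q}` is Lebesgue-null. [folklore] -/
theorem volume_singleton_qpt : volume ({qpt} : Set (Fin 2 → ℝ)) = 0 := measure_singleton qpt

/-- The integrand-`1` representation on a `ℚ`-semialgebraic planar set of finite area. [folklore] -/
def oneRep (σ : Set (Fin 2 → ℝ)) (hσ : IsSemialgebraic ℚ σ) (hfin : volume σ ≠ ⊤) :
    KZ.IntegralRep 2 where
  domain := σ
  integrand := fun _ => 1
  isSemialgebraic_domain := hσ
  isSemialgebraicFunOn_integrand := isSemialgebraicFunOn_one hσ
  integrableOn := integrableOn_const hfin

/-- The domain of `oneRep σ` is `σ`. [folklore] -/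
@[simp] theorem domain_oneRep (σ : Set (Fin 2 → ℝ)) (hσ : IsSemialgebraic ℚ σ) (hfin : volume σ ≠ ⊤) :
    (oneRep σ hσ hfin).domain = σ := rfl

/-- The integrand of `oneRep σ` is the constant `1`. [folklore] -/
@[simp] theorem integrand_oneRep (σ : Set (Fin 2 → ℝ)) (hσ : IsSemialgebraic ℚ σ)
    (hfin : volume σ ≠ ⊤) (x : Fin 2 → ℝ) : (oneRep σ hσ hfin).integrand x = 1 := rfl

/-- `oneRep σ` is a planar integrand-1 representation. [folklore] -/
theorem integrand_oneRep_eq_one (σ : Set (Fin 2 → ℝ)) (hσ : IsSemialgebraic ℚ σ) (hfin : volume σ ≠ ⊤) :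
    ∀ p ∈ (oneRep σ hσ hfin).domain, (oneRep σ hσ hfin).integrand p = 1 := fun _ _ => rfl

/-- `[(0,1)², 1]`. [folklore] -/
def sqRep : KZ.IntegralRep 2 := oneRep sq isSemialgebraic_sq (by simp [volume_sq])

/-- `[{q}, 1]` — a null planar `ℚ`-region. [folklore] -/
def ptRep : KZ.IntegralRep 2 := oneRep {qpt} isSemialgebraic_singleton_qpt (by simp)

/-- `[(0,1)² ∪ {q}, 1]` — the unit square with a far-away point added. [folklore] -/
def sqPtRep : KZ.IntegralRep 2 :=
  oneRep (sq ∪ {qpt}) (isSemialgebraic_sq.union isSemialgebraic_singleton_qpt) (by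
    refine ((measure_union_le _ _).trans_lt ?_).ne
    simp [volume_sq])

/-- `[ℝ², 1/(2(1+x²)(1+y²))]` — a representation of finite value on a domain of INFINITE area
(its integrand is not `1`). [folklore] -/
def planeRep : KZ.IntegralRep 2 where
  domain := univ
  integrand := fun x => (KZ.graphWeight x)⁻¹ / 2
  isSemialgebraic_domain := isSemialgebraic_univ
  isSemialgebraicFunOn_integrand := KZ.isSemialgebraicFunOn_graphWeight_inv_half isSemialgebraic_univ
  integrableOn := (KZ.integrable_graphWeight_inv.div_const 2).integrableOn

/-- `ℝ²` has infinite area. [folklore] -/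
theorem volume_univ_plane : volume (univ : Set (Fin 2 → ℝ)) = ⊤ := by
  rw [volume_pi, Measure.pi_univ]
  simp

/-- The empty planar representation has integrand `1` on its (empty) domain, vacuously. [folklore] -/
theorem integrand_empty_eq_one : ∀ p ∈ (KZ.IntegralRep.empty 2).domain,
    (KZ.IntegralRep.empty 2).integrand p = 1 := fun _ h => h.elim

end Models

/-! ## §3 Soundness and sanity of the conclusion shape -/

/-- The Jacobian determinant of the identity of the plane is `1`. [folklore] -/
theorem det_id_two : (ContinuousLinearMap.id ℝ (Fin 2 → ℝ)).det = 1 := by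
  simp [ContinuousLinearMap.det]

/-- `0` is a change-of-variables instance (identity on the empty representation). [folklore] -/
theorem zero_mem_changeOfVariablesRel : (0 : KZ.FormalRep) ∈ KZ.changeOfVariablesRel := by
  refine ⟨2, KZ.IntegralRep.empty 2, KZ.IntegralRep.empty 2, id, fun _ => ContinuousLinearMap.id ℝ _,
    isSemialgebraicMapOn_id (KZ.IntegralRep.empty 2).isSemialgebraic_domain,
    fun x _ => hasFDerivWithinAt_id x _, injOn_id _, by simp, fun _ h => h.elim, by simp⟩

/-- The conclusion holds on the DIAGONAL for every planar integrand-1 representation (`Φ = id`). [folklore] -/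
theorem equidecomposable_refl {r : KZ.IntegralRep 2} (h : ∀ p ∈ r.domain, r.integrand p = 1) :
    Equidecomposable r r :=
  ⟨r, r, subset_rfl, by simp, subset_rfl, by simp, h, h,
    ⟨2, r, r, id, fun _ => ContinuousLinearMap.id ℝ _, isSemialgebraicMapOn_id r.isSemialgebraic_domain,
      fun x _ => hasFDerivWithinAt_id x _, injOn_id _, by simp, fun x hx => by simp [det_id_two],
      by simp⟩⟩

/-- The conclusion holds for every pair of NULL regions (`s = s' = ∅`). [folklore] -/
theorem equidecomposable_of_null {r r' : KZ.IntegralRep 2} (hr : volume r.domain = 0)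
    (hr' : volume r'.domain = 0) : Equidecomposable r r' :=
  ⟨KZ.IntegralRep.empty 2, KZ.IntegralRep.empty 2, empty_subset _, by simpa using hr,
    empty_subset _, by simpa using hr', integrand_empty_eq_one, integrand_empty_eq_one,
    by simpa using zero_mem_changeOfVariablesRel⟩

/-- For an integrand-1 representation the value is the area of the domain. [folklore] -/
theorem value_eq_volume_of_integrand_one {r : KZ.IntegralRep 2}
    (h : ∀ p ∈ r.domain, r.integrand p = 1) : r.value = (volume r.domain).toReal := by
  unfold KZ.IntegralRep.value
  rw [setIntegral_congr_fun (KZ.IntegralRep.measurableSet_domain_holds r) (fun x hx => h x hx),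
    setIntegral_const, measureReal_def, smul_eq_mul, mul_one]

/-- Full-measure restrictions of integrand-1 representations have the same value. [folklore] -/
theorem value_eq_of_subset_of_volume_diff {a b : KZ.IntegralRep 2}
    (ha : ∀ p ∈ a.domain, a.integrand p = 1) (hb : ∀ p ∈ b.domain, b.integrand p = 1)
    (hsub : b.domain ⊆ a.domain) (hn : volume (a.domain \ b.domain) = 0) : a.value = b.value := by
  rw [value_eq_volume_of_integrand_one ha, value_eq_volume_of_integrand_one hb]
  congr 1
  apply le_antisymm
  · calc volume a.domain = volume (b.domain ∪ (a.domain \ b.domain)) := by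
          rw [union_sdiff_cancel hsub]
      _ ≤ volume b.domain + volume (a.domain \ b.domain) := measure_union_le _ _
      _ = volume b.domain := by rw [hn, add_zero]
  · exact measure_mono hsub

/-- **The conclusion shape is sound for area**: equidecomposable regions (modulo null sets, one
change-of-variables instance) have equal area — no junk instance of the conclusion relates regions
of different area, so a kill of the crux needs a genuinely non-equidecomposable pair of EQUAL area,
i.e. a counterexample to the open Monge problem (§1). [folklore] -/
theorem value_eq_of_equidecomposable {r r' : KZ.IntegralRep 2}
    (hr : ∀ p ∈ r.domain, r.integrand p = 1) (hr' : ∀ p ∈ r'.domain, r'.integrand p = 1)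
    (h : Equidecomposable r r') : r.value = r'.value := by
  obtain ⟨s, s', hs, hnull, hs', hnull', h1, h1', hcov⟩ := h
  have hvs : s.value = s'.value := by
    have := KZ.eval_eq_zero_of_mem_changeOfVariablesRel_holds hcov
    rwa [map_sub, KZ.eval_of, KZ.eval_of, sub_eq_zero] at this
  rw [value_eq_of_subset_of_volume_diff hr h1 hs hnull, hvs,
    ← value_eq_of_subset_of_volume_diff hr' h1' hs' hnull']

/-- Under `PlanarTransport` the conclusion shape is exactly "equal area". [folklore] -/
theorem equidecomposable_iff_value_eq (hT : PlanarTransport) {r r' : KZ.IntegralRep 2}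
    (hr : ∀ p ∈ r.domain, r.integrand p = 1) (hr' : ∀ p ∈ r'.domain, r'.integrand p = 1) :
    Equidecomposable r r' ↔ r.value = r'.value :=
  ⟨value_eq_of_equidecomposable hr hr', hT r r' hr hr'⟩

end Summit.KontsevichZagierPeriods.SymplecticScissors.PlanarSAZylevNegative
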